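import Summits.BirchSwinnertonDyer.BirchSwinnertonDyer.Theorems.ByReductionTypeAtTwoRankOneSigmaHeightResidueCertificate
import Literature.NumberTheory.EllipticCurves.PAdicHeightsLogProofs
import HarnessLib

/-!
# Route `ByReductionTypeAtTwo`, crux `RankOneAtTwoBigImageOddLocal` (item stmt-BirchSwinnertonDyer-23715), line AN62, σ₀-LEMMA BLOCK
# (cell `bsd-f1-sign2`, planner seat `-an` g50; `--supports 23715`, helper):
# **THE UNIFIED LOG-FREE LEVEL-ONE LAW `⟨Q,Q⟩_D ≡ (a − 1) − (a − 1)²/2 − 8a₄ (mod 32)`, `a = num x(Q)`, BOTH PARITIES OF `a₂`**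

HONEST FRAMING (D-0036/D-0054): THEOREMS ONLY (no definition, no named fact, no `sorry`, no instance).  (1) The third-order `2`-adic
logarithm: `‖log₂(1+t) − t + t²/2‖ ≤ ‖t‖³` for `‖t‖ ≤ ¼` (`norm_padicLog_one_add_sub_add_le`; the series `Σ (−1)^{n+1}tⁿ/n`, tree
`hasSum_padicLog_holds`, `‖1/3‖₂ = 1`, `(n+3)·4⁻ⁿ ≤ 1`).  (2) At level one (`‖x‖₂ = 4`, `a₁ = 0`, `ℤ`-integral) `‖a − 1‖₂ ≤ ¼`, so
`‖log₂ a − ((a−1) − (a−1)²/2)‖₂ ≤ 1/64` (`norm_padicLog_num_sub_quadratic_le`).  (3) With the unconditional level-one law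
(`‖⟨Q,Q⟩_D − log₂ a + 8a₄‖ ≤ 1/32`): **`‖⟨Q,Q⟩_D − ((a−1) − (a−1)²/2 − 8a₄)‖₂ ≤ 1/32`** for EVERY level-one `Q` with non-singular
reduction everywhere and every σ-form datum `D` (`norm_pairing_sub_quadratic_le`) — the pairing is a QUADRATIC POLYNOMIAL IN `num x(Q)`
modulo `32`; for `a₂` odd (`‖⟨Q,Q⟩‖₂ = ¼`) this pins the unit part of `⟨Q,Q⟩_D` modulo `8`, for `a₂` even it is `…ValuationLaw`'s
congruence.  The `mod 64` analogue `⟨Q,Q⟩ ≡ (a−1) − (a−1)²/2 + 24a₄ − 32a₃` is a TYPED CANDIDATE only (MEMO-an §54 (54.11); data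
840/840).  Nothing here is a statement about `BSDp`; item 23715 stays OPEN; BSD is proved for no curve.
References: [cite: Gouvea1993PadicNumbers, §5.7 Prop. 5.7.8] [cite: Iwasawa1972PadicL, §4.4] [cite: MazurSteinTate2006, §1].
-/

set_option autoImplicit false

noncomputable section

open scoped Classical

open WeierstrassCurve PowerSeries Literature Literature.NumberTheory.EllipticCurves

namespace Summit.BirchSwinnertonDyer.BirchSwinnertonDyer.Theorems

namespace NaiveSigmaLogAtTwo

/-- `(n + 3)·rⁿ ≤ 1` for `0 ≤ r ≤ ¼`, `n ≥ 1`. -/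
theorem aux_nat_add_three_mul_pow_le {r : ℝ} (hr0 : 0 ≤ r) (hr : r ≤ 4⁻¹) {n : ℕ} (hn : 1 ≤ n) :
    ((n : ℝ) + 3) * r ^ n ≤ 1 := by
  have h4 : ((n : ℝ) + 3) ≤ 4 ^ n := by
    have : ∀ m : ℕ, ((m + 1 : ℕ) : ℝ) + 3 ≤ 4 ^ (m + 1) := by
      intro m
      induction m with
      | zero => norm_num
      | succ m ih => push_cast at ih ⊢; rw [pow_succ]; linarith [ih]
    obtain ⟨m, rfl⟩ := Nat.exists_eq_add_of_le' hn
    exact_mod_cast this m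
  have hrn : r ^ n ≤ (4⁻¹ : ℝ) ^ n := pow_le_pow_left₀ hr0 hr n
  calc ((n : ℝ) + 3) * r ^ n ≤ 4 ^ n * (4⁻¹ : ℝ) ^ n :=
        mul_le_mul h4 hrn (pow_nonneg hr0 n) (by positivity)
    _ = 1 := by rw [← mul_pow]; norm_num

/-- **Third-order `2`-adic logarithm**: `‖log₂(1+t) − t + t²/2‖ ≤ ‖t‖³` for `‖t‖ ≤ ¼`. [cite: Gouvea1993PadicNumbers, §5.7 Prop. 5.7.8] -/
theorem norm_padicLog_one_add_sub_add_le {t : ℚ_[2]} (ht : ‖t‖ ≤ 4⁻¹) :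
    ‖padicLog 2 (1 + t) - t + t ^ 2 / 2‖ ≤ ‖t‖ ^ 3 := by
  set r := ‖t‖ with hr
  have hr0 : 0 ≤ r := norm_nonneg t
  have hr1 : r < 1 := by linarith
  have hsum := hasSum_padicLog_holds 2 (y := 1 + t) (by rw [add_sub_cancel_left]; exact hr1)
  have hsum' : HasSum (fun n : ℕ => -((-t) ^ (n + 1)) / (n + 1 : ℚ_[2])) (padicLog 2 (1 + t)) := by
    refine hsum.congr_fun fun n => ?_
    rw [show (1 : ℚ_[2]) - (1 + t) = -t by ring]
  have htail := (hasSum_nat_add_iff' 2).mpr hsum'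
  have h2 : ∑ i ∈ Finset.range 2, -((-t) ^ (i + 1)) / (i + 1 : ℚ_[2]) = t - t ^ 2 / 2 := by
    rw [Finset.sum_range_succ, Finset.sum_range_one]; push_cast; ring
  rw [h2] at htail
  rw [show padicLog 2 (1 + t) - t + t ^ 2 / 2 = padicLog 2 (1 + t) - (t - t ^ 2 / 2) by ring, ← htail.tsum_eq]
  refine IsUltrametricDist.norm_tsum_le_of_forall_le_of_nonneg (by positivity) fun n => ?_
  have hn : ((n : ℚ_[2]) + 2 + 1) = ((n + 3 : ℕ) : ℚ_[2]) := by push_cast; ring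
  rw [norm_div, norm_neg, norm_pow, norm_neg, show ((n + 2 : ℕ) : ℚ_[2]) + 1 = ((n + 3 : ℕ) : ℚ_[2]) by push_cast; ring,
    ← hr, div_eq_mul_inv, ← norm_inv]
  rcases Nat.eq_zero_or_pos n with rfl | hn1
  · -- `‖1/3‖₂ = 1`
    have h3 : ‖((0 + 3 : ℕ) : ℚ_[2])⁻¹‖ ≤ 1 := by
      rw [norm_inv]
      have hle : ‖((3 : ℤ) : ℚ_[2])‖ ≤ 1 := Padic.norm_int_le_one _
      have hlt : ¬ ‖((3 : ℤ) : ℚ_[2])‖ < 1 := by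
        rw [Padic.norm_intCast_lt_one_iff]; norm_num
      have h1 : ‖((3 : ℤ) : ℚ_[2])‖ = 1 := le_antisymm hle (not_lt.mp hlt)
      have : ((0 + 3 : ℕ) : ℚ_[2]) = ((3 : ℤ) : ℚ_[2]) := by push_cast; ring
      rw [this, h1, inv_one]
    calc r ^ (0 + 2 + 1) * ‖((0 + 3 : ℕ) : ℚ_[2])⁻¹‖ ≤ r ^ (0 + 2 + 1) * 1 :=
          mul_le_mul_of_nonneg_left h3 (pow_nonneg hr0 _)
      _ = r ^ 3 := by ring
  · calc r ^ (n + 2 + 1) * ‖((n + 3 : ℕ) : ℚ_[2])⁻¹‖ ≤ r ^ (n + 2 + 1) * ((n + 3 : ℕ) : ℝ) :=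
          mul_le_mul_of_nonneg_left (norm_inv_natCast_le (by omega)) (pow_nonneg hr0 _)
      _ = (((n : ℝ) + 3) * r ^ n) * r ^ 3 := by push_cast; ring
      _ ≤ 1 * r ^ 3 := mul_le_mul_of_nonneg_right (aux_nat_add_three_mul_pow_le hr0 ht hn1) (pow_nonneg hr0 _)
      _ = r ^ 3 := one_mul _

/-- **`‖log₂ num x − ((num x − 1) − (num x − 1)²/2)‖₂ ≤ 1/64` at level one** (`a₁ = 0`). [cite: Gouvea1993PadicNumbers, §5.7 Prop. 5.7.8] -/
theorem norm_padicLog_num_sub_quadratic_le (V : WeierstrassCurve ℚ) [V.IsIntegral ℤ] {x y : ℚ} (h : V.toAffine.Nonsingular x y)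
    (ha1 : V.a₁ = 0) (hx : ‖(x : ℚ_[2])‖ = 4) :
    ‖padicLog 2 (x.num : ℚ_[2]) - (((x.num : ℚ_[2]) - 1) - ((x.num : ℚ_[2]) - 1) ^ 2 / 2)‖ ≤ 64⁻¹ := by
  have ht4 := norm_cast_num_sub_one_le_quarter V h ha1 hx
  have h3 := norm_padicLog_one_add_sub_add_le ht4
  rw [show (1 : ℚ_[2]) + ((x.num : ℚ_[2]) - 1) = (x.num : ℚ_[2]) by ring] at h3
  rw [show padicLog 2 (x.num : ℚ_[2]) - (((x.num : ℚ_[2]) - 1) - ((x.num : ℚ_[2]) - 1) ^ 2 / 2)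
      = padicLog 2 (x.num : ℚ_[2]) - ((x.num : ℚ_[2]) - 1) + ((x.num : ℚ_[2]) - 1) ^ 2 / 2 by ring]
  refine h3.trans ?_
  have := pow_le_pow_left₀ (norm_nonneg _) ht4 3
  exact this.trans (by norm_num)

/-- **THE UNIFIED LOG-FREE LEVEL-ONE LAW (kernel)**: for every level-one point `Q = (x, y)` (`‖x‖₂ = 4`) with non-singular reduction
everywhere on a `ℤ`-integral model with `a₁ = 0`, and every σ-form height datum `D` at `2` (both parities of `a₂`):
**`‖⟨Q,Q⟩_D − ((num x − 1) − (num x − 1)²/2 − 8a₄)‖₂ ≤ 1/32`**. [cite: MazurSteinTate2006, §1] [cite: Gouvea1993PadicNumbers, §5.7] -/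
theorem norm_pairing_sub_quadratic_le (V : WeierstrassCurve ℚ) [V.IsIntegral ℤ] (ha1 : V.a₁ = 0)
    (Sq : ℚ_[2]⟦X⟧) (h0 : constantCoeff Sq = 0) (h1 : coeff 1 Sq = 0) (h2 : coeff 2 Sq = 1) (h3 : coeff 3 Sq = 0)
    (hODE : (V.baseChange ℚ_[2]).SatisfiesSigmaSqODE Sq 0) (D : PAdicHeightData V 2)
    (hD : ∀ {x y : ℚ} (h : V.toAffine.Nonsingular x y), V.SatisfiesLocalConditions 2 (.some x y h) →
      D.pairing (.some x y h) (.some x y h) = padicLog 2 ((x.den : ℚ) : ℚ_[2]) - padicLog 2 (padicEval Sq (-(x : ℚ_[2]) / y)))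
    {x y : ℚ} (h : V.toAffine.Nonsingular x y) (hx : ‖(x : ℚ_[2])‖ = 4)
    (hns : ∀ ℓ : ℕ, ℓ.Prime → V.HasNonsingularReductionAt ℓ x y) :
    ‖D.pairing (.some x y h) (.some x y h)
        - (((x.num : ℚ_[2]) - 1) - ((x.num : ℚ_[2]) - 1) ^ 2 / 2 - 8 * (V.a₄ : ℚ_[2]))‖ ≤ 32⁻¹ := by
  have hB := norm_pairing_sub_padicLog_num_add_le_of_norm_eq_four V ha1 Sq h0 h1 h2 h3 hODE D hD h hx hns
  have hL := norm_padicLog_num_sub_quadratic_le V h ha1 hx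
  have e : D.pairing (.some x y h) (.some x y h)
      - (((x.num : ℚ_[2]) - 1) - ((x.num : ℚ_[2]) - 1) ^ 2 / 2 - 8 * (V.a₄ : ℚ_[2]))
      = (D.pairing (.some x y h) (.some x y h) - padicLog 2 (x.num : ℚ_[2]) + 8 * (V.a₄ : ℚ_[2]))
        + (padicLog 2 (x.num : ℚ_[2]) - (((x.num : ℚ_[2]) - 1) - ((x.num : ℚ_[2]) - 1) ^ 2 / 2)) := by ring
  rw [e]
  exact (Padic.nonarchimedean _ _).trans (max_le hB (hL.trans (by norm_num)))

end NaiveSigmaLogAtTwo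

end Summit.BirchSwinnertonDyer.BirchSwinnertonDyer.Theorems
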